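import Summits.BirchSwinnertonDyer.BirchSwinnertonDyer.Theorems.ManinLocalTwoThreeStevensShortModelParam
import Summits.BirchSwinnertonDyer.BirchSwinnertonDyer.Theorems.ManinLocalTwoThreeStevensIntegralityIntOfShortModelParam
import Summits.BirchSwinnertonDyer.BirchSwinnertonDyer.Theorems.ManinLocalTwoThreeStevensCurveRatPresentationDatum
import Literature.NumberTheory.EllipticCurves.EichlerShimuraConstructionProofs
import Literature.NumberTheory.EllipticCurves.GlobalMinimalModelProofs
import Literature.NumberTheory.EllipticCurves.ModularCurveNeronLatticeProofs
import Literature.NumberTheory.EllipticCurves.IsogenyVariableChangeProofs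
import Literature.NumberTheory.EllipticCurves.IsogenyCompProofs
import Literature.NumberTheory.EllipticCurves.ManinConstantGamma1Gamma0LedgerProofs
import HarnessLib

/-!
# CES holds: the `X₁(N)`-optimal datum on a GLOBALLY MINIMAL model — Conrad–Edixhoven–Stein's Lemma 6.1.6 by the
# formal group (route `ManinLocalTwoThree`, cruxes C2 stmt-BirchSwinnertonDyer-22967 / C3 stmt-…-22968, rung stmt-…-22445;
# cell bsd-f2-manin, prover p2 gen 25; CES-discharge programme, stage 3 — DISCHARGE of the named fact
# `Literature.NumberTheory.EllipticCurves.ModularForms.exists_optimal_gamma1ParametrizationData`)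

The named fact CES (`ManinConstantGamma1Gamma0Comparison.lean`; Conrad–Edixhoven–Stein 2003 §6.1 / Stevens 1989 §2): for a
globally minimal elliptic `W₀/ℚ` with a lattice-optimal `X₀(N)`-datum `D₀` there is a GLOBALLY MINIMAL elliptic `W₁`,
`ℚ`-isogenous to `W₀`, with an OPTIMAL `X₁(N)`-datum (`Λ_{W₁} = c₁Λ₁(f)`, `c₁ ∈ ℤ`).  p3 gen 21 proved the flat version
CES♭ (`StevensCurve.exists_optimal_gamma1ParametrizationData_flat`: the Stevens curve `ℂ/Λ₁(f)` on its short model, `c = 1`)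
and named the missing stage 3: `c₁ ∈ ℤ` for the MINIMAL model (Conrad–Edixhoven–Stein Lemma 6.1.6).  THIS FILE proves it and
discharges CES:

* `int_of_neronLattice_eq_smul_periodLatticeGamma1` — **the `Γ₁(N)`-twin of Edixhoven 1991 Prop. 2**: if a globally minimal
  `W'/ℚ` with newform `f` has a Néron-type period pair with lattice EXACTLY `q·Λ₁(f)` (`q ∈ ℚ`), and `℘_{Λ₁(f)}(ℰ_f)` has a
  rational `Γ₁(N)`-presentation, then `q ∈ ℤ` — by `…StevensShortModelParam` (Steps 1–3 for `Λ₁(f)`: p2's `Γ₁` formal series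
  with Deligne–Serre bounded denominators) and `…StevensIntegralityIntOfShortModelParam` (the tree's local programme at
  every prime, lattice-free);
* `exists_optimal_gamma1ParametrizationData_holds : exists_optimal_gamma1ParametrizationData` — **CES**: the global minimal
  model `W₁ = C • E₁` (`hasGlobalMinimalModel_rat_holds`) of the Stevens curve `E₁` (p3's `exists_stevensDatum_rat_presentation`:
  short model, `Λ(D₁.L) = Λ₁(f)`, `c = 1`, rational presentation), its Néron pair `L'` with `Λ(L') = u·Λ₁(f)`, `u = u(C) ∈ ℚ`
  (`IsNeronLatticeOf.lattice_eq_mulLeft_of_smul`), `u ∈ ℤ` by the first theorem, and the optimal `X₁(N)`-datum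
  `(f, L', c₁ := u)` on `W₁` (uniformisation `IsNeronLatticeOf.exists_uniformize_holds`, degree
  `FlatGamma1Datum.exists_gamma1_modularDegree`).

HONEST FRAMING: a PRINTED theorem (CES Lemma 6.1.6 with Stevens 1989 §2), proved here by a route not in print (Honda-type
formal-group integrality prime by prime instead of the `q`-expansion principle on `X₁(N)_ℤ` and Néron models); fact-free,
standard axioms, no definitions.  It discharges the hypothesis `(hCES : exists_optimal_gamma1ParametrizationData)` carried by
the route's conditional theorems; it does NOT prove C2, C3, Stevens' `c₁ = ±1`, Manin's conjecture or BSD.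
[cite: ConradEdixhovenStein2003, §6.1, Def. 6.1.4, Rem. 6.1.5 and Lemma 6.1.6 (pp. 380–381)] [cite: Stevens1989, §2 (Prop. (1.4), (2.8))]
[cite: EdixhovenManin1991, Prop. 2] [cite: Honda1970, Thm. 9 (pp. 240–241)] [cite: DeligneSerreASENS1974, Prop. 2.7 (2.7.2)]
-/

set_option autoImplicit false
-- lint-debt: the directory name repeats the summit name (sibling precedent `ManinLocalTwoThreeStevensCurveDatum.lean`)
set_option linter.dupNamespace false

noncomputable section

open PowerSeries
open UpperHalfPlane hiding I
open scoped MatrixGroups PeriodPair ModularForm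
open CongruenceSubgroup
open WeierstrassCurve Literature.NumberTheory.EllipticCurves Literature.NumberTheory.EllipticCurves.ModularForms
open Summit.BirchSwinnertonDyer.BirchSwinnertonDyer.Theorems.ManinLocalTwoThree.StevensCurve

namespace Summit.BirchSwinnertonDyer.BirchSwinnertonDyer.Theorems.ManinLocalTwoThree.StevensIntegrality

variable {N : ℕ} [NeZero N]

/-- **The `Γ₁(N)`-twin of Edixhoven's Prop. 2 (Conrad–Edixhoven–Stein 2003, Lemma 6.1.6: the Manin constant of the
`X₁(N)`-optimal curve on its minimal model is an integer).**  Let `W'/ℚ` be globally minimal with newform `f`, `L'` a Néron-type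
period pair with `Λ(L') = q·Λ₁(f)` exactly (`q ∈ ℚ`), and let `℘_{Λ₁(f)}(ℰ_f)` admit a rational `Γ₁(N)`-presentation `(F, G)`
(w.r.t. any period pair `M` with `Λ(M) = Λ₁(f)`).  Then `q ∈ ℤ`. [cite: ConradEdixhovenStein2003, Lemma 6.1.6]
[cite: EdixhovenManin1991, Prop. 2] [cite: Stevens1989, §2] -/
theorem int_of_neronLattice_eq_smul_periodLatticeGamma1
    {W' : WeierstrassCurve ℚ} [W'.IsElliptic] [W'.IsGloballyMinimal] {f : CuspForm (Gamma0 N) 2}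
    {L' : PeriodPair} (hf : IsNewformOf W' f) (hL' : IsNeronLatticeOf (W'.baseChange ℂ) L')
    {q : ℚ} (hq : ∀ z ∈ periodLatticeGamma1 f, (q : ℂ) * z ∈ L'.lattice)
    (hq' : ∀ z ∈ L'.lattice, ∃ w ∈ periodLatticeGamma1 f, z = q * w)
    {M : PeriodPair} (hM : ∀ x, x ∈ M.lattice ↔ x ∈ periodLatticeGamma1 f)
    {k : ℤ} (hk : 1 ≤ k) (F G : CuspForm (Gamma1 N) k) (hG : G ≠ 0)
    (hFG : ∀ τ : ℍ, eichlerIntegral f τ ∉ M.lattice → ℘[M] (eichlerIntegral f τ) * G τ = F τ)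
    (hFr : ∀ n, ∃ r : ℚ, (r : ℂ) = cuspCoeff F n) (hGr : ∀ n, ∃ r : ℚ, (r : ℂ) = cuspCoeff G n) :
    ∃ m : ℤ, (m : ℚ) = q := by
  obtain ⟨a₄, a₆, E, hEe, z, P, Q, P₂, Q₂, vc, hE, hz0, hQ, hPQ, hQ₂, hPQ₂, hlog, hC, hCpos, hsign⟩ :=
    exists_shortModelParam_of_neronLattice_eq_smul_periodLatticeGamma1 hf hL' hq hq' hM hk F G hG hFG hFr hGr
  haveI := hEe
  obtain ⟨m, hm⟩ := int_of_shortModelParam hE hz0 hQ hPQ hQ₂ hPQ₂ hlog hC hCpos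
  rcases hsign with h | h
  · exact ⟨m, by rw [hm, h]⟩
  · exact ⟨-m, by rw [Int.cast_neg, hm, h, neg_neg]⟩

/-- **CES HOLDS — DISCHARGE of the named fact `exists_optimal_gamma1ParametrizationData`** (Conrad–Edixhoven–Stein 2003,
§6.1 with Lemma 6.1.6; Stevens 1989, §2): for every globally minimal elliptic `W₀/ℚ` with a lattice-optimal `X₀(N)`-datum
`D₀` there are a GLOBALLY MINIMAL elliptic `W₁/ℚ`, `ℚ`-isogenous to `W₀`, and an OPTIMAL `X₁(N)`-datum `D₁` of `W₁`
(`Λ_{W₁} = c₁·Λ₁(f)`, `c₁ ∈ ℤ`): the global minimal model of the Stevens curve `ℂ/Λ₁(f)`, whose Néron lattice `u·Λ₁(f)` has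
`u ∈ ℤ` by `int_of_neronLattice_eq_smul_periodLatticeGamma1`. [cite: ConradEdixhovenStein2003, §6.1, Lemma 6.1.6]
[cite: Stevens1989, §2 (Prop. (1.4), (2.8))] -/
theorem exists_optimal_gamma1ParametrizationData_holds : exists_optimal_gamma1ParametrizationData := by
  intro W₀ _ _ N _ D₀ hopt
  classical
  have hf0 : D₀.f ≠ 0 := D₀.isNewformOf.1.ne_zero
  -- the Stevens datum on the short model `E₁`, with a rational `Γ₁(N)`-presentation
  obtain ⟨E₁, hE₁, D₁, hf₁, hc₁, -, hL₁, hiso₁, k, F, G, hk, hG, hFG, hFr, hGr⟩ :=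
    exists_stevensDatum_rat_presentation D₀ hopt
  haveI := hE₁
  -- its global minimal model `W₁ = C • E₁` and a Néron pair `L'` with `Λ(L') = u·Λ₁(f)`
  obtain ⟨C, hCmin⟩ := hasGlobalMinimalModel_rat_holds E₁
  haveI := hCmin
  haveI hW₁e : ((C • E₁).baseChange ℂ).IsElliptic := by
    rw [WeierstrassCurve.baseChange]; infer_instance
  obtain ⟨L', hL'⟩ := exists_isNeronLatticeOf_holds ((C • E₁).baseChange ℂ)
  have hu0 : (C.u : ℚ) ≠ 0 := C.u.ne_zero
  have huC : ((C.u : ℚ) : ℂ) ≠ 0 := by exact_mod_cast hu0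
  have hΛ' := IsNeronLatticeOf.lattice_eq_mulLeft_of_smul C D₁.isNeronLattice hL'
  have hf' : IsNewformOf (C • E₁) D₀.f := by
    rw [← hf₁]
    exact D₁.isNewformOf.of_isIsogenous (isIsogenous_of_smul E₁ C)
  have hq : ∀ z ∈ periodLatticeGamma1 D₀.f, ((C.u : ℚ) : ℂ) * z ∈ L'.lattice := fun z hz ↦ by
    rw [hΛ', PeriodPair.mul_mem_mulLeft_lattice, hL₁]
    exact hz
  have hq' : ∀ z ∈ L'.lattice, ∃ w ∈ periodLatticeGamma1 D₀.f, z = ((C.u : ℚ) : ℂ) * w := fun z hz ↦ by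
    rw [hΛ', PeriodPair.mem_mulLeft_lattice, hL₁] at hz
    exact ⟨(((C.u : ℚ) : ℂ))⁻¹ * z, hz, by rw [← mul_assoc, mul_inv_cancel₀ huC, one_mul]⟩
  -- `u ∈ ℤ`
  obtain ⟨m, hm⟩ := int_of_neronLattice_eq_smul_periodLatticeGamma1 hf' hL' hq hq' hL₁ hk F G hG hFG hFr hGr
  have hmC : (m : ℂ) = ((C.u : ℚ) : ℂ) := by rw [← hm, Rat.cast_intCast]
  have hm0 : (m : ℂ) ≠ 0 := by rw [hmC]; exact huC
  have hmle : ∀ z ∈ periodLatticeGamma1 D₀.f, (m : ℂ) * z ∈ L'.lattice := fun z hz ↦ by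
    rw [hmC]; exact hq z hz
  -- the `X₁(N)`-datum `(f, L', c₁ := m)` on `W₁ = C • E₁`
  obtain ⟨u, hker, hsurj, hspec⟩ := IsNeronLatticeOf.exists_uniformize_holds hL'
  obtain ⟨d, hd, hfin⟩ := FlatGamma1Datum.exists_gamma1_modularDegree hf0 (L := L') hm0 hmle
  have hker' : L'.lattice.toAddSubgroup = u.ker :=
    SetLike.coe_injective (by rw [Submodule.coe_toAddSubgroup, hker])
  let e : ℂ ⧸ L'.lattice.toAddSubgroup ≃+ ((C • E₁).baseChange ℂ).toAffine.Point :=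
    QuotientAddGroup.liftEquiv L'.lattice.toAddSubgroup hsurj hker'
  have he : ∀ x : ℂ, e.toEquiv (x : ℂ ⧸ L'.lattice.toAddSubgroup) = u x := fun _ ↦ rfl
  have key := (FlatGamma1Datum.finite_setOf_natCard_gamma1FiberOrbits_ne_iff e.toEquiv
    (fun τ : ℍ ↦ (((m : ℂ) * eichlerIntegral D₀.f τ : ℂ) : ℂ ⧸ L'.lattice.toAddSubgroup)) d).mpr hfin
  simp only [he] at key
  refine ⟨C • E₁, inferInstance, hCmin,
    { f := D₀.f
      isNewformOf := hf'
      L := L'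
      isNeronLattice := hL'
      uniformize := u
      ker_uniformize := hker
      uniformize_surjective := hsurj
      uniformize_spec := hspec
      c := m
      smul_periodLatticeGamma1_le := hmle
      deg := d
      deg_pos := hd
      deg_spec := key }, ?_, ?_⟩
  · -- `W₁ ∼ W₀`
    exact (isIsogenous_of_smul E₁ C).trans' hiso₁
  · -- optimality: `Λ(L') = m·Λ₁(f)`
    intro z hz
    obtain ⟨w, hw, rfl⟩ := hq' z hz
    exact ⟨w, hw, by rw [hmC]⟩

/-- **Unconditional form of the tree's `exists_gamma1_maninConstant_dvd`** (its two fact hypotheses are now theorems: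
`exists_optimal_gamma1ParametrizationData_holds` above and `cesnaviciusNeururerSaha_lemma_6_5_dvd_holds`): every globally minimal
`W₀` with a lattice-optimal `X₀(N)`-datum `D₀` has a `ℚ`-isogenous globally minimal `W₁` with an OPTIMAL `X₁(N)`-datum `D₁`
whose Manin constant divides that of `D₀` (`c₁ ∣ c₀`). [cite: ConradEdixhovenStein2003, §6.1, Lemma 6.1.6]
[cite: CesnaviciusNeururerSaha2023, Lemma 6.5 (p. 42)] -/
theorem exists_gamma1_maninConstant_dvd_holds {W₀ : WeierstrassCurve ℚ} [W₀.IsElliptic] [W₀.IsGloballyMinimal]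
    (D₀ : ModularParametrizationData W₀ N) (h₀ : ∀ z ∈ D₀.L.lattice, ∃ w ∈ periodLattice D₀.f, z = D₀.c * w) :
    ∃ (W₁ : WeierstrassCurve ℚ) (_ : W₁.IsElliptic) (_ : W₁.IsGloballyMinimal)
      (D₁ : Gamma1ParametrizationData W₁ N), IsIsogenous W₁ W₀ ∧ D₁.IsOptimal ∧
        D₁.maninConstant ∣ D₀.maninConstant :=
  exists_gamma1_maninConstant_dvd exists_optimal_gamma1ParametrizationData_holds
    cesnaviciusNeururerSaha_lemma_6_5_dvd_holds D₀ h₀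

end Summit.BirchSwinnertonDyer.BirchSwinnertonDyer.Theorems.ManinLocalTwoThree.StevensIntegrality

end
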